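import Literature.AnabelianGeometry.EtaleTheta.KummerDataOfCoreSection
import Literature.AnabelianGeometry.EtaleTheta.ThetaCohomologyInversion
import Literature.AnabelianGeometry.EtaleTheta.ConstantMultipleRigidityEquivarianceProofs
import Literature.AnabelianGeometry.EtaleTheta.SettingModelChiAnchoredPoints
import Literature.AnabelianGeometry.EtaleTheta.SettingModelChiKummerDataCusp
import HarnessLib

/-!
# Cuspidal `K̈`-points of `Ÿ` from Galois sections INTO A CUSP DECOMPOSITION GROUP — the constructor for
# `ThetaSetting.CuspidalPointDd`, and its inhabitant at the χ-twisted model with a cusp (`modelχ′`)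

S. Mochizuki, *The étale theta function …*, Publ. RIMS **45** (2009) [EtTh], §1, Prop. 1.4 (iii) p. 22 («if `L` is a
finite extension of `K`, `y ∈ Ÿ(L)` … the cusps …, a section `G_L → D_y` compatible with the canonical integral
structure»), Prop. 1.5 p. 23, §2 p. 35 («`x` the unique cusp of `X^log` … `D_x`») [cite: MochizukiEtTh2009, Prop 1.4 (iii) p.22];
S. Mochizuki, *Galois sections …* [GalSect], Def. 4.1 (iii) p. 33 [cite: MochizukiGalSect2005, §4 p.33].

abc-iut cell, layer L2, seat abc-iut-w5-d029 (gen 5) — NV-L2 census v4 row `ThetaSetting.CuspidalPointDd` (12 consumers,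
0 producers at 10:53Z).  Class (b) CONSTRUCTIONS of abc-iut-L2-t1's frozen record `CuspidalPointDd` (`GalSectIntegralStructures`)
in the exact pattern of abc-iut-L2-t6's `KummerData.nonCuspidalPointOfSection` / `KummerCore.anchoredPointOfSections`
(`ThetaCohomologySectionPoints`, `KummerDataOfCoreSection` — consumed BY NAME, nothing restated); no interface clause touched,
no `Prop` fact, no instance.

(A) GENERIC.  Given a Kummer datum `E` presented through a Galois section (`eK`, `heK` as in L2-t6's constructor), a cusp
`x` of `X`, and a continuous section `s` of the augmentation on `G_K̈` whose image lies in `D_x ∩ Π^tp_Ÿ` and is closed: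
**`KummerData.cuspidalPointDdOfSection`** — `D_y := D_x ∩ Π^tp_Ÿ` (`conj := 1`), `S := s(G_K̈)`, canonical integral
structure `:= {S}` (DATA, as the interface says), coordinate any `±q̈^a`, `evalAt :=` L2-t6's `evalAtOfSection`; the group
theory of the fields (`D_y ↠ G_K̈` via `map_aug_GtpYdd_eq_GKdd`, `S ∩ I_y = 1`, `S·I_y = D_y`) is proved here once.
`cuspidalPointDdOfSection_isAnchored` — ANCHORED (`CuspidalPointDd.IsAnchored`, abc-iut-L2-t12/L2-t1) as soon as `hanch`
(pulling `log(Ü)` back along `s` presents `κ(coord)`).  **`KummerCore.cuspidalPointDdOfSections`** — the same for L2-t6's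
section datum `toKummerDataOfSection s` and a point-section `s'`.

(B) AT `modelχ′` (this seat's F5c, abc-iut-w5-d171's `kummerCoreχ'`).  `kummerDataχ'Sec` := the section datum of `kummerCoreχ'`
along `inr` (L2-t6's `kummerDataχSec` transcribed; the hypotheses are L2-t6's `modelχ` lemmas, accepted at `modelχ′` by `rfl`
on the carriers); **`cuspidalPointDdχ' : CuspidalPointDd (kummerDataχ'Sec p)`** — the cusp of `curveχ′`, `D_y = b^{2Ẑ} ⋊ G_{ℚ_p}`
(`= D_x ∩ Π^tp_Ÿ`), section L2-t6's `κ_1²`-twisted Galois factor `sectionOfUnitχ 1` (which LANDS IN `b^Ẑ ⋊ G_{ℚ_p} = D_x`),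
coordinate `Ü(y) = 1 = q̈⁰` («the component labelled 0»); **`cuspidalPointDdχ'_isAnchored`** (L2-t6's
`comap_sectionOfUnitχ_logUdd 1`), `cuspidalPointDdχ'_isOnLabelZero`; census headline
`ThetaSetting.exists_isCusp_and_nonempty_cuspidalPointDd_isAnchored`.

HONEST FRAMING: semi-synthetic model (the cusp is the Tate-twisted `b`-axis: at this model L2-t6's «non-cuspidal» section points
and this cuspidal point have decomposition groups inside the SAME `D_x` — the interface does not see the geometry that separates
them; consistency evidence for the typed interface only); nothing of [EtTh]/[GalSect] asserted; no side taken on [IUTchIII]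
Cor. 3.12; typed ≠ proved; inhabited ≠ endorsed.
-/

noncomputable section

namespace Literature.AnabelianGeometry.EtaleTheta

open Literature.AnabelianGeometry.SemiGraphs
open scoped Pointwise

namespace ThetaSetting

variable {p : ℕ} [Fact p.Prime] {D : ThetaSetting p}

/-! ### (A) Group theory of a section into `D_x ∩ Π^tp_Ÿ` -/

section SectionIntoCusp

variable (s : GQp p →* D.PiTemp) (hsec : ∀ g : GQp p, g ∈ D.GKdd → D.aug (s g) = g)
  (hsY : D.GKdd.map s ≤ D.GtpYdd) {x : D.Pt} (hsD : D.GKdd.map s ≤ D.decomp x)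

include hsec hsY hsD in
/-- `D_x ∩ Π^tp_Ÿ ↠ G_K̈` when a section over `G_K̈` lands in it (`aug(Π^tp_Ÿ) = G_K̈` gives `≤`).
[cite: MochizukiEtTh2009, Prop 1.4 (iii) p.22] -/
theorem map_aug_decomp_inf_GtpYdd : (D.decomp x ⊓ D.GtpYdd).map D.aug.toMonoidHom = D.GKdd := by
  refine le_antisymm ((Subgroup.map_mono inf_le_right).trans D.map_aug_GtpYdd_eq_GKdd.le) fun g hg => ?_
  exact ⟨s g, ⟨hsD ⟨g, hg, rfl⟩, hsY ⟨g, hg, rfl⟩⟩, hsec g hg⟩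

include hsec in
/-- `s(G_K̈) ∩ Δ^tp_X = 1` (a section meets the inertia trivially). [cite: MochizukiGalSect2005, §4 p.33] -/
theorem map_section_inf_deltaTemp : D.GKdd.map s ⊓ D.DeltaTemp = ⊥ := by
  rw [eq_bot_iff]
  rintro _ ⟨⟨g, hg, rfl⟩, hΔ⟩
  have h1 : D.aug (s g) = 1 := hΔ
  rw [hsec g hg] at h1
  rw [Subgroup.mem_bot, h1, map_one]

include hsec hsY hsD in
/-- `s(G_K̈) · I_y = D_y` for `D_y = D_x ∩ Π^tp_Ÿ`, `I_y = D_y ∩ Δ^tp_X`. [cite: MochizukiGalSect2005, §4 p.33] -/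
theorem map_section_sup_inertia :
    D.GKdd.map s ⊔ (D.decomp x ⊓ D.GtpYdd ⊓ D.DeltaTemp) = D.decomp x ⊓ D.GtpYdd := by
  refine le_antisymm (sup_le (le_inf hsD hsY) inf_le_left) fun d hd => ?_
  have hg : D.aug.toMonoidHom d ∈ D.GKdd := by
    rw [← map_aug_decomp_inf_GtpYdd s hsec hsY hsD]
    exact ⟨d, hd, rfl⟩
  have hsd : s (D.aug d) ∈ D.GKdd.map s := ⟨_, hg, rfl⟩
  have hdec : d = s (D.aug d) * ((s (D.aug d))⁻¹ * d) := by group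
  rw [hdec]
  refine Subgroup.mul_mem _ (Subgroup.mem_sup_left hsd) (Subgroup.mem_sup_right ?_)
  refine ⟨Subgroup.mul_mem _ (Subgroup.inv_mem _ (le_inf hsD hsY hsd)) hd, ?_⟩
  have hg' : D.aug d ∈ D.GKdd := hg
  change D.aug.toMonoidHom ((s (D.aug d))⁻¹ * d) = 1
  rw [map_mul, map_inv]
  change (D.aug (s (D.aug d)))⁻¹ * D.aug d = 1
  rw [hsec _ hg', inv_mul_cancel]

end SectionIntoCusp

/-! ### (A) The constructor -/

namespace KummerData

variable (E : D.KummerData) (s : GQp p →* D.PiTemp) (hs : Continuous s)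
  (hsec : ∀ g : GQp p, g ∈ D.GKdd → D.aug (s g) = g) (hsY : D.GKdd.map s ≤ D.GtpYdd)
  (eK : E.KddHat ≃* ContH1 (D.toTheta.comp s) D.DeltaTheta D.GKdd)

include hsec in
/-- **A cuspidal `K̈`-point of `Ÿ` from a Galois section into a cusp decomposition group** (non-vacuity constructor for
`CuspidalPointDd`): `D_y := D_x ∩ Π^tp_Ÿ`, `S := s(G_K̈)` closed with `S ≤ D_x`, canonical integral structure `{S}`,
coordinate `±q̈^a`, `evalAt :=` pull-back along `s` read through the presentation `eK`. [cite: MochizukiEtTh2009, Prop 1.4 (iii) p.22] -/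
def cuspidalPointDdOfSection
    (heK : ∀ c : E.KddHat, ContH1.comap D.toTheta D.DeltaTheta s hs hsY
      (D.inflTheta D.GtpYdd (E.kumYdd c)) = eK c)
    {x : D.Pt} (hx : D.IsCusp x) (hsD : D.GKdd.map s ≤ D.decomp x)
    (hclosed : IsClosed ((D.GKdd.map s : Subgroup D.PiTemp) : Set D.PiTemp))
    (u : (↥D.Kdd)ˣ) (hu : ∃ a : ℤ, ((u : D.Kdd) : PadicAlgCl p) = D.qdd ^ a ∨ ((u : D.Kdd) : PadicAlgCl p) = -(D.qdd ^ a)) :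
    CuspidalPointDd E where
  Dpt := D.decomp x ⊓ D.GtpYdd
  Dpt_le := inf_le_right
  cusp := x
  cusp_isCusp := hx
  conj := 1
  Dpt_eq := by rw [map_one, one_smul]
  map_aug_Dpt := map_aug_decomp_inf_GtpYdd s hsec hsY hsD
  coord := u
  coord_eq := hu
  sec := D.GKdd.map s
  sec_le := le_inf hsD hsY
  isClosed_sec := hclosed
  sec_inf := map_section_inf_deltaTemp s hsec
  sec_sup := map_section_sup_inertia s hsec hsY hsD
  canonicalIntegralDd := {D.GKdd.map s}
  sec_mem := Set.mem_singleton _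
  evalAt := E.evalAtOfSection s hs eK
  evalAt_kum := E.evalAtOfSection_kum s hs hsY eK heK

/-- The decomposition group of the constructed cusp datum is `D_x ∩ Π^tp_Ÿ`. [cite: MochizukiEtTh2009, Prop 1.4 (iii) p.22] -/
@[simp] theorem Dpt_cuspidalPointDdOfSection
    (heK : ∀ c : E.KddHat, ContH1.comap D.toTheta D.DeltaTheta s hs hsY
      (D.inflTheta D.GtpYdd (E.kumYdd c)) = eK c)
    {x : D.Pt} (hx : D.IsCusp x) (hsD : D.GKdd.map s ≤ D.decomp x)
    (hclosed : IsClosed ((D.GKdd.map s : Subgroup D.PiTemp) : Set D.PiTemp))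
    (u : (↥D.Kdd)ˣ) (hu : ∃ a : ℤ, ((u : D.Kdd) : PadicAlgCl p) = D.qdd ^ a ∨ ((u : D.Kdd) : PadicAlgCl p) = -(D.qdd ^ a)) :
    (E.cuspidalPointDdOfSection s hs hsec hsY eK heK hx hsD hclosed u hu).Dpt = D.decomp x ⊓ D.GtpYdd := rfl

/-- Its section subgroup is `s(G_K̈)`. [cite: MochizukiEtTh2009, Prop 1.4 (iii) p.22] -/
@[simp] theorem sec_cuspidalPointDdOfSection
    (heK : ∀ c : E.KddHat, ContH1.comap D.toTheta D.DeltaTheta s hs hsY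
      (D.inflTheta D.GtpYdd (E.kumYdd c)) = eK c)
    {x : D.Pt} (hx : D.IsCusp x) (hsD : D.GKdd.map s ≤ D.decomp x)
    (hclosed : IsClosed ((D.GKdd.map s : Subgroup D.PiTemp) : Set D.PiTemp))
    (u : (↥D.Kdd)ˣ) (hu : ∃ a : ℤ, ((u : D.Kdd) : PadicAlgCl p) = D.qdd ^ a ∨ ((u : D.Kdd) : PadicAlgCl p) = -(D.qdd ^ a)) :
    (E.cuspidalPointDdOfSection s hs hsec hsY eK heK hx hsD hclosed u hu).sec = D.GKdd.map s := rfl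

/-- **The constructed cusp datum is ANCHORED** as soon as `log(Ü)` pulled back along `s` presents `κ(Ü(y))` (`hanch`);
`evalAt` is injective automatically. [cite: MochizukiEtTh2009, Prop 1.4 (iii) p.22] -/
theorem cuspidalPointDdOfSection_isAnchored
    (heK : ∀ c : E.KddHat, ContH1.comap D.toTheta D.DeltaTheta s hs hsY
      (D.inflTheta D.GtpYdd (E.kumYdd c)) = eK c)
    {x : D.Pt} (hx : D.IsCusp x) (hsD : D.GKdd.map s ≤ D.decomp x)
    (hclosed : IsClosed ((D.GKdd.map s : Subgroup D.PiTemp) : Set D.PiTemp))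
    (u : (↥D.Kdd)ˣ) (hu : ∃ a : ℤ, ((u : D.Kdd) : PadicAlgCl p) = D.qdd ^ a ∨ ((u : D.Kdd) : PadicAlgCl p) = -(D.qdd ^ a))
    (hanch : ContH1.comap D.toTheta D.DeltaTheta s hs hsY (D.inflTheta D.GtpYdd E.logUdd) = eK (E.toKddHat u)) :
    (E.cuspidalPointDdOfSection s hs hsec hsY eK heK hx hsD hclosed u hu).IsAnchored where
  evalAt_injective := E.evalAtOfSection_injective s hs hsec eK
  evalAt_logUdd := by
    change E.evalAtOfSection s hs eK (ContH1.res D.toTheta D.DeltaTheta hsY (D.inflTheta D.GtpYdd E.logUdd)) =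
      E.toKddHat u
    rw [evalAtOfSection_apply, comap_section_res, hanch, MulEquiv.symm_apply_apply]

end KummerData

/-! ### (A) The same for a Kummer core's SECTION datum and a point-section `s'` -/

namespace KummerCore

variable (C : D.KummerCore) (s : GQp p →* D.PiTemp) (hs : Continuous s) (hsec : ∀ σ : GQp p, D.aug (s σ) = σ)
  (hsY : D.GK.map s ≤ D.GtpY) (hsYdd : D.GKdd.map s ≤ D.GtpYdd)
  (s' : GQp p →* D.PiTemp) (hs' : Continuous s') (hsec' : ∀ σ : GQp p, D.aug (s' σ) = σ)
  (hsYdd' : D.GKdd.map s' ≤ D.GtpYdd)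

include hsec' in
/-- **A cuspidal point of the section datum `toKummerDataOfSection s` at a point-section `s'` into `D_x`** (the shape
of the cusps of `Ÿ` over the cusp `x` of `X`; cf. `nonCuspidalPointOfSections`). [cite: MochizukiEtTh2009, Prop 1.4 (iii) p.22] -/
def cuspidalPointDdOfSections {x : D.Pt} (hx : D.IsCusp x) (hsD' : D.GKdd.map s' ≤ D.decomp x)
    (hclosed' : IsClosed ((D.GKdd.map s' : Subgroup D.PiTemp) : Set D.PiTemp))
    (u : (↥D.Kdd)ˣ) (hu : ∃ a : ℤ, ((u : D.Kdd) : PadicAlgCl p) = D.qdd ^ a ∨ ((u : D.Kdd) : PadicAlgCl p) = -(D.qdd ^ a)) :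
    CuspidalPointDd (C.toKummerDataOfSection s hs hsec hsY hsYdd) :=
  (C.toKummerDataOfSection s hs hsec hsY hsYdd).cuspidalPointDdOfSection s' hs' (fun g _ => hsec' g) hsYdd'
    (C.sectionPresentation s hs hsec hsY hsYdd s' hsec')
    (C.comap_section'_inflTheta_kumYdd s hs hsec hsY hsYdd s' hs' hsec' hsYdd') hx hsD' hclosed' u hu

include hsec' in
/-- … ANCHORED under `hanch` (pulling the core's `log(Ü)` back along `s'` gives the transported Kummer class of `u`).
[cite: MochizukiEtTh2009, Prop 1.4 (iii) p.22] -/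
theorem cuspidalPointDdOfSections_isAnchored {x : D.Pt} (hx : D.IsCusp x) (hsD' : D.GKdd.map s' ≤ D.decomp x)
    (hclosed' : IsClosed ((D.GKdd.map s' : Subgroup D.PiTemp) : Set D.PiTemp))
    (u : (↥D.Kdd)ˣ) (hu : ∃ a : ℤ, ((u : D.Kdd) : PadicAlgCl p) = D.qdd ^ a ∨ ((u : D.Kdd) : PadicAlgCl p) = -(D.qdd ^ a))
    (hanch : ContH1.comap D.toTheta D.DeltaTheta s' hs' hsYdd' (D.inflTheta D.GtpYdd C.logUdd) =
      C.sectionPresentation s hs hsec hsY hsYdd s' hsec' (C.toKddHatOfSection s hs hsYdd u)) :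
    (C.cuspidalPointDdOfSections s hs hsec hsY hsYdd s' hs' hsec' hsYdd' hx hsD' hclosed' u hu).IsAnchored :=
  (C.toKummerDataOfSection s hs hsec hsY hsYdd).cuspidalPointDdOfSection_isAnchored s' hs' (fun g _ => hsec' g) hsYdd'
    (C.sectionPresentation s hs hsec hsY hsYdd s' hsec')
    (C.comap_section'_inflTheta_kumYdd s hs hsec hsY hsYdd s' hs' hsec' hsYdd') hx hsD' hclosed' u hu hanch

end KummerCore

end ThetaSetting

/-! ### (B) The cusp of `modelχ′` as an ANCHORED cuspidal point of `Ÿ` -/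

namespace SettingModel

open ThetaSetting

variable (p : ℕ) [Fact p.Prime]

/-- **The SECTION Kummer datum of the CUSPED χ-model**: abc-iut-w5-d171's core `kummerCoreχ'` read along the Galois factor
`inr` (abc-iut-L2-t6's `kummerDataχSec`, transcribed; the four hypotheses are L2-t6's `modelχ` lemmas, the carriers agree).
[cite: MochizukiEtTh2009, Prop 1.5 p.23] -/
def kummerDataχ'Sec : (ThetaSetting.modelχ' p).KummerData :=
  (kummerCoreχ' p).toKummerDataOfSection SemidirectProduct.inr (continuous_inr_modelχ p) (aug_modelχ_inr p)
    (map_inr_GK_le_GtpY_modelχ p) (map_inr_GKdd_le_GtpYdd_modelχ p)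

/-- The `κ_u²`-twisted Galois factor LANDS IN THE CUSP DECOMPOSITION GROUP `b^Ẑ ⋊ G_{ℚ_p}` of `curveχ′`
(`sectionOfUnitχ u σ = (b^{2κ_u(σ)}, σ)`). [cite: MochizukiEtTh2009, §1 p.13] -/
theorem map_sectionOfUnitχ_le_decomp_modelχ' (u : (↥(ThetaSetting.modelχ p).Kdd)ˣ) (x : (ThetaSetting.modelχ' p).Pt) :
    (ThetaSetting.modelχ' p).GKdd.map (sectionOfUnitχ p u) ≤ (ThetaSetting.modelχ' p).decomp x := by
  rintro _ ⟨σ, -, rfl⟩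
  change sectionOfUnitχ p u σ ∈ cuspDecompχ p
  rw [mem_cuspDecompχ_iff, sectionOfUnitχ_def]
  exact bPowGfp_mem_bAxisGfp _

/-- `G_K̈ = G_{ℚ_p}` at the cusped χ-model (`K̈ = K₂ = ℚ_p`). [cite: MochizukiEtTh2009, §1 p.17] -/
theorem fixingSubgroup_Kdd_modelχ' : (ThetaSetting.modelχ' p).Kdd.fixingSubgroup = ⊤ := fixingSubgroup_Kdd_modelχ p

/-- The image of a continuous section of `aug` over ALL of `G_{ℚ_p}` is closed in `Π^tp_X = Γ ⋊ G_{ℚ_p}` (it is the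
preimage of `1` under the continuous map `g ↦ g · s(aug g)⁻¹`). [cite: MochizukiGalSect2005, §4 p.33] -/
theorem isClosed_map_sectionOfUnitχ (u : (↥(ThetaSetting.modelχ p).Kdd)ˣ) :
    IsClosed (((ThetaSetting.modelχ' p).GKdd.map (sectionOfUnitχ p u) : Subgroup (PiTpχ p)) : Set (PiTpχ p)) := by
  haveI : T2Space (PiTpχ p) := Semidirect.t2Space_of (isInducing_leftRightχ p)
  have hGK : (ThetaSetting.modelχ' p).GKdd = ⊤ := fixingSubgroup_Kdd_modelχ' p
  have hset : (((ThetaSetting.modelχ' p).GKdd.map (sectionOfUnitχ p u) : Subgroup (PiTpχ p)) : Set (PiTpχ p)) =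
      (fun g : PiTpχ p => g * (sectionOfUnitχ p u (augχ p g))⁻¹) ⁻¹' {1} := by
    ext g
    constructor
    · rintro ⟨σ, -, rfl⟩
      show sectionOfUnitχ p u σ * (sectionOfUnitχ p u (augχ p (sectionOfUnitχ p u σ)))⁻¹ = 1
      rw [show augχ p (sectionOfUnitχ p u σ) = σ from aug_modelχ_sectionOfUnitχ p u σ, mul_inv_cancel]
    · intro hg
      have hg' : g * (sectionOfUnitχ p u (augχ p g))⁻¹ = 1 := hg
      refine ⟨augχ p g, by rw [hGK]; trivial, ?_⟩
      rw [mul_inv_eq_one] at hg'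
      exact hg'.symm
  rw [hset]
  exact isClosed_singleton.preimage
    ((continuous_id.mul ((continuous_sectionOfUnitχ p u).comp (augχ p).continuous).inv))

/-- `1 ∈ K̈^×` is a cusp coordinate: `1 = q̈⁰`. [cite: MochizukiEtTh2009, Prop 1.4 (i) p.21] -/
theorem one_eq_qdd_zpow_zero :
    ∃ a : ℤ, (((1 : (↥(ThetaSetting.modelχ' p).Kdd)ˣ) : (ThetaSetting.modelχ' p).Kdd) : PadicAlgCl p) =
        (ThetaSetting.modelχ' p).qdd ^ a ∨
      (((1 : (↥(ThetaSetting.modelχ' p).Kdd)ˣ) : (ThetaSetting.modelχ' p).Kdd) : PadicAlgCl p) =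
        -((ThetaSetting.modelχ' p).qdd ^ a) :=
  ⟨0, Or.inl (by rw [zpow_zero]; rfl)⟩

/-- **THE CUSP OF `curveχ′` AS A CUSPIDAL `K̈`-POINT OF `Ÿ`** for the section datum `kummerDataχ'Sec`: `D_y = D_x ∩ Π^tp_Ÿ
= b^{2Ẑ} ⋊ G_{ℚ_p}`, section the `κ_1²`-twisted Galois factor, canonical integral structure `{that section}`, coordinate
`Ü(y) = 1 = q̈⁰`. [cite: MochizukiEtTh2009, Prop 1.4 (iii) p.22] -/
def cuspidalPointDdχ' : CuspidalPointDd (kummerDataχ'Sec p) :=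
  (kummerCoreχ' p).cuspidalPointDdOfSections SemidirectProduct.inr (continuous_inr_modelχ p) (aug_modelχ_inr p)
    (map_inr_GK_le_GtpY_modelχ p) (map_inr_GKdd_le_GtpYdd_modelχ p) (sectionOfUnitχ p 1)
    (continuous_sectionOfUnitχ p 1) (aug_modelχ_sectionOfUnitχ p 1) (map_sectionOfUnitχ_GKdd_le_GtpYdd p 1)
    (x := ()) trivial (map_sectionOfUnitχ_le_decomp_modelχ' p 1 ()) (isClosed_map_sectionOfUnitχ p 1) 1
    (one_eq_qdd_zpow_zero p)

/-- **It is ANCHORED**: `log(Ü)|_y = Ü(y) = 1` (abc-iut-L2-t6's `comap_sectionOfUnitχ_logUdd` at `u = 1`, accepted at the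
cusped carrier by `rfl` on the records). [cite: MochizukiEtTh2009, Prop 1.4 (iii) p.22] -/
theorem cuspidalPointDdχ'_isAnchored : (cuspidalPointDdχ' p).IsAnchored :=
  (kummerCoreχ' p).cuspidalPointDdOfSections_isAnchored SemidirectProduct.inr (continuous_inr_modelχ p)
    (aug_modelχ_inr p) (map_inr_GK_le_GtpY_modelχ p) (map_inr_GKdd_le_GtpYdd_modelχ p) (sectionOfUnitχ p 1)
    (continuous_sectionOfUnitχ p 1) (aug_modelχ_sectionOfUnitχ p 1) (map_sectionOfUnitχ_GKdd_le_GtpYdd p 1) trivial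
    (map_sectionOfUnitχ_le_decomp_modelχ' p 1 ()) (isClosed_map_sectionOfUnitχ p 1) 1 (one_eq_qdd_zpow_zero p)
    (comap_sectionOfUnitχ_logUdd p 1)

/-- Its coordinate is `1`. [cite: MochizukiEtTh2009, Prop 1.4 (iii) p.22] -/
@[simp] theorem coord_cuspidalPointDdχ' : (cuspidalPointDdχ' p).coord = 1 := rfl

/-- Its decomposition group is `D_x ∩ Π^tp_Ÿ`. [cite: MochizukiEtTh2009, Prop 1.4 (iii) p.22] -/
theorem Dpt_cuspidalPointDdχ' :
    (cuspidalPointDdχ' p).Dpt = cuspDecompχ p ⊓ (ThetaSetting.modelχ' p).GtpYdd := rfl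

/-- **It lies «over the component labelled 0»** (`Ü(y) = ±1`, abc-iut-L2-t12's `IsOnLabelZero`).
[cite: MochizukiEtTh2009, Prop 1.5 (iii) p.23] -/
theorem cuspidalPointDdχ'_isOnLabelZero : (cuspidalPointDdχ' p).IsOnLabelZero := Or.inl rfl

/-- **CENSUS: `CuspidalPointDd → WITNESSED`** (anchored, on label `0`) at a theta setting with the guard and a cusp.
[cite: MochizukiEtTh2009, Prop 1.4 (iii) p.22] -/
theorem _root_.Literature.AnabelianGeometry.EtaleTheta.ThetaSetting.exists_isCusp_and_nonempty_cuspidalPointDd_isAnchored :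
    ∃ (D : ThetaSetting p) (E : D.KummerData) (y : CuspidalPointDd E),
      D.IsEtThOrigin ∧ (∃ x : D.Pt, D.IsCusp x) ∧ y.IsAnchored ∧ y.IsOnLabelZero :=
  ⟨ThetaSetting.modelχ' p, kummerDataχ'Sec p, cuspidalPointDdχ' p, ThetaSetting.modelχ'_isEtThOrigin p, ⟨(), trivial⟩,
    cuspidalPointDdχ'_isAnchored p, cuspidalPointDdχ'_isOnLabelZero p⟩

end SettingModel

end Literature.AnabelianGeometry.EtaleTheta

end
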